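import Summits.BirchSwinnertonDyer.BirchSwinnertonDyer.Theorems.CMKolyvaginAtInertTwoReciprocityLeafAtTwo
import Summits.BirchSwinnertonDyer.BirchSwinnertonDyer.Theorems.CMKolyvaginAtInertTwoCebotarevLeafAtTwo
import Summits.BirchSwinnertonDyer.Rank1Residual.P2.CMKolyvaginMachineBindersAtTwo
import Literature.NumberTheory.EllipticCurves.HeegnerPointsKolyvaginPrimaryPointsProofs
import Literature.NumberTheory.EllipticCurves.HeegnerPointsKolyvaginGoodReductionProofs
import Literature.NumberTheory.EllipticCurves.BSDRankZeroDensity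
import HarnessLib

/-!
# Route `CMKolyvaginAtInertTwo`, crux `CMKolyvaginExactAtInertTwo` (stmt-BirchSwinnertonDyer-24277):
# THE `τ`-PART DESCENT AT `p = 2` — `y_K ∉ 2E(K)` + the machine's two inputs at `(2, 1)` ⟹
# complex conjugation acts TRIVIALLY on `Sel₂(E/K)` (memo §2, KERNEL-STATUS-p2-port.md §3 item 2)

Seat `bsd-line-cmk2-p1` g6 (cell `bsd-print-cf2`); helper (`--supports stmt-BirchSwinnertonDyer-24277`).
THEOREMS ONLY: no definition, no named fact, no `sorry`; no item is closed; BSD is not proved by this.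

WHAT. The first Selmer-level statement of the Heegner Kolyvagin system AT `p = 2` in the kernel
(`Cruxes/CMExactDescentAtTwo/MEMO-tau-line-at-two.md` §2: "`y_K ∉ 2E(K)` + ONE depth-`1` Kolyvagin
prime ⟹ `(1+τ)·Sel₂(E/K) = 0`", modulo the standard Euler-system infrastructure at `2`):

* `conjAct_eq_self_of_mem_selmerGroup_two` — `E/ℚ` elliptic with `ρ̄_{E,2}` onto `GL₂(𝔽₂)` and
  `Δ_E < 0`, `K` imaginary quadratic with `Δ_E ∉ K²` and conjugation `c`, `P = y_K ∈ E(K)` a Heegner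
  point of level `N` with `P ∉ 2E(K)`; GIVEN the two inputs of the kernel Kolyvagin machine at
  `(p, M) = (2, 1)` in their binder shapes (the Heegner-point system `hpoints` — Gross (4.4), Props.
  5.3, 6.2 — and the pairing-form reciprocity `hRT` — McCallum Prop. 2.2 + Lemma 5.3 —, exactly the
  `M = 1` instances of the binders of `KolyvaginDescent.pow_smul_sha_primary_eq_zero_at_of_pointsM_of_
  reciprocityFinset`; at `2` / CM they are HYPOTHESES, not print — typed as data by ty2 in
  `P2.KolyvaginMachine`), **`c_* s = s` for every `s ∈ Sel₂(E/K)`**.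
  PROOF (memo §2, kernel form). Let `u = c_* s − s ≠ 0`; `x = c(1) = δ₂ y_K ≠ 0` (`P ∉ 2E(K)`,
  `kummerMapTorsion_ker`); both are `c_*`-invariant (`2·H¹(K, E₂) = 0`). The Čebotarev leaf at `2`
  (`KolyvaginImageTwo.exists_kolyvaginPrime_gt_two`, p597930; family `(u, x)` or `(x)` if `u = x`)
  gives a Kolyvagin prime `ℓ` of `(2, 1)` in Gross's form with `u_λ ≠ 0` AND `x_λ ≠ 0`; by Gross's
  Prop. 6.2 (2) (the `hpoints` local criterion at `λ ∣ ℓ`) `x_λ ≠ 0` says Kolyvagin's class `d = c(ℓ)`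
  is NOT Selmer at `λ`; `d` is a `(−ε)`-eigenclass, Selmer off `ℓ` (Prop. 6.2 (1)) and at infinity
  (`K` totally complex); so leaf (B) at two (`KolyvaginDescentTwo.lemma_5_3_descent_two`, p607160) gives
  `u_λ = (c_* s − s)_λ = 0` — contradiction.
* `conjAct_eq_self_of_families_two` — the same with the inputs packaged as ty2's DATA
  `KolyvaginMachine.PointSystemFamily N W K P 2 ⊤` / `ReciprocityFamily N W K 2 ⊤` (p601266).

What this is NOT (memo §1): the `τ`-FIXED part `Sel₂(E/K)^τ = res H¹(ℚ, E₂) ∩ Sel₂(E/K)` is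
untouched — single Kolyvagin primes cannot shrink it; so this is the "easy half" of rung Z at `2`,
not the crux `CMKolyvaginExactAtInertTwo` (stubs `stub_upper` / `stub_lower` remain research-level).
On the habitat H₂ of the route (`HasCM`, `CMInert W 2`, `ρ̄₂` onto) the hypotheses `Δ_E < 0`,
`Δ_E ∉ K²` are automatic (`KolyvaginEigenTwo.…_of_cmInert_two`, p591040;
`KolyvaginImageTwo.not_isSquare_algebraMap_Δ_of_cmInert_two_of_heegner`, p596346).

References: [GrossLMS1991] B. H. Gross, *Kolyvagin's work on modular elliptic curves*, LMS LN 153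
(1991), Prop. 2.1 and §§8–10 (the odd-`p` argument this replaces at `2`), (4.4), Props. 5.3, 6.2;
[McCallumLMS1991] §2 Prop. 2.2, §3 Cor. 3.2, §5 Lemma 5.3; the memo cited above (seat g2).
-/

-- single-conjunct summit: `Summit.BirchSwinnertonDyer.BirchSwinnertonDyer.…` repeats the name by design
set_option linter.dupNamespace false
set_option autoImplicit false

noncomputable section

open scoped Classical
open WeierstrassCurve NumberField IsDedekindDomain Field
open Literature.NumberTheory.GaloisRepresentations Literature.NumberTheory.EllipticCurves

namespace Summit.BirchSwinnertonDyer.BirchSwinnertonDyer.Theorems.KolyvaginDescentTwo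

/-! ## Independence mod `2` of small families in a group killed by `2` -/

/-- In an additive group whose elements satisfy `z + z = 0`, `a • z = (a % 2) • z`. [folklore] -/
theorem zsmul_eq_emod_two_zsmul {G : Type*} [AddCommGroup G] (h2 : ∀ z : G, z + z = 0) (a : ℤ) (z : G) :
    a • z = (a % 2) • z := by
  obtain ⟨k, hk⟩ : ∃ k : ℤ, a = a % 2 + k * 2 := ⟨a / 2, by omega⟩
  conv_lhs => rw [hk]
  rw [add_zsmul, mul_zsmul, two_zsmul, h2, zsmul_zero, add_zero]

/-- A non-zero element of a group killed by `2` is independent mod `2` (family of length `1`). [folklore] -/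
theorem dvd_two_of_sum_one {G : Type*} [AddCommGroup G] (h2 : ∀ z : G, z + z = 0) {x : G} (hx : x ≠ 0)
    (a : Fin 1 → ℤ) (ha : ∑ i, a i • ![x] i = 0) : ∀ i, (((2 : ℕ) : ℕ) : ℤ) ∣ a i := by
  intro i
  obtain rfl : i = 0 := Subsingleton.elim i 0
  rw [Fin.sum_univ_one, Matrix.cons_val_zero, zsmul_eq_emod_two_zsmul h2] at ha
  rcases Int.emod_two_eq_zero_or_one (a 0) with h | h
  · exact Int.dvd_of_emod_eq_zero h
  · rw [h, one_zsmul] at ha; exact absurd ha hx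

/-- Two distinct non-zero elements of a group killed by `2` are independent mod `2`. [folklore] -/
theorem dvd_two_of_sum_two {G : Type*} [AddCommGroup G] (h2 : ∀ z : G, z + z = 0) {u x : G} (hu : u ≠ 0)
    (hx : x ≠ 0) (hux : u ≠ x) (a : Fin 2 → ℤ) (ha : ∑ i, a i • ![u, x] i = 0) :
    ∀ i, (((2 : ℕ) : ℕ) : ℤ) ∣ a i := by
  have hneg : ∀ z : G, -z = z := fun z ↦ neg_eq_of_add_eq_zero_left (h2 z)
  rw [Fin.sum_univ_two, Matrix.cons_val_zero, Matrix.cons_val_one, Matrix.cons_val_zero,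
    zsmul_eq_emod_two_zsmul h2 (a 0), zsmul_eq_emod_two_zsmul h2 (a 1)] at ha
  have key : a 0 % 2 = 0 ∧ a 1 % 2 = 0 := by
    rcases Int.emod_two_eq_zero_or_one (a 0) with h0 | h0 <;>
      rcases Int.emod_two_eq_zero_or_one (a 1) with h1 | h1 <;> rw [h0, h1] at ha
    · exact ⟨h0, h1⟩
    · rw [zero_zsmul, one_zsmul, zero_add] at ha; exact absurd ha hx
    · rw [one_zsmul, zero_zsmul, add_zero] at ha; exact absurd ha hu
    · rw [one_zsmul, one_zsmul, add_eq_zero_iff_eq_neg, hneg] at ha; exact absurd ha hux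
  intro i
  fin_cases i
  · exact Int.dvd_of_emod_eq_zero key.1
  · exact Int.dvd_of_emod_eq_zero key.2

/-! ## The `τ`-part descent at `p = 2` -/

-- `K : Type` (universe 0) as in the Čebotarev leaf at `2` (p597930) and the route items
variable (W : WeierstrassCurve ℚ) {K : Type} [Field K] [NumberField K]

/-- **`τ = 1` on `Sel₂(E/K)` when `y_K ∉ 2E(K)`, given the Kolyvagin machine's two inputs at
`(p, M) = (2, 1)`** (the `τ`-part descent of memo §2; statement and proof in the module docstring).
Hypotheses: `K` imaginary quadratic with conjugation `c ≠ 1`; `P ∈ E(K)` a Heegner point of level `N`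
with `2·Q ≠ P` for all `Q ∈ E(K)`; `ρ̄_{E,2}` onto, `Δ_E < 0`, `Δ_E ∉ K²` (the Čebotarev leaf at `2`);
the level written `q` with `q = 2` (instantiate `q := 2 ^ 1` to consume the machine's `M = 1` binders
literally); `hpoints` / `hRT` = the binders of
`KolyvaginDescent.pow_smul_sha_primary_eq_zero_at_of_pointsM_of_reciprocityFinset` at `p = 2`, `M = 1`,
for this `c` (Gross (4.4), Props. 5.3, 6.2; McCallum Prop. 2.2 + Lemma 5.3 — at `2` these are
hypotheses). Conclusion: `c_* s = s` for all `s ∈ Sel₂(E/K)`.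
[cite: GrossLMS1991, Prop. 2.1 with §10 (proof), (4.4), Props. 5.3, 6.2]
[cite: McCallumLMS1991, §2 Prop. 2.2, §3 Cor. 3.2, §5 Lemma 5.3] -/
theorem conjAct_eq_self_of_mem_selmerGroup_two {N : ℕ} [NeZero N] [W.IsElliptic]
    (hK : IsImaginaryQuadratic K) {P : (W.baseChange K).toAffine.Point} (hP : IsHeegnerPoint N W K P)
    (hρ : W.HasSurjectiveModNGaloisRep 2) (hΔ : W.Δ < 0) (hΔK : ¬ IsSquare (W.baseChange K).Δ)
    {c : K ≃ₐ[ℚ] K} (hc : c ≠ 1) (hy : ∀ Q : (W.baseChange K).toAffine.Point, 2 • Q ≠ P)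
    {q : ℕ} (hq : q = 2)
    (hpoints : ∀ (hdiv : ∀ Q : geomPoints (W.baseChange K), ∃ R, (q : ℤ) • R = Q),
      ∃ (ε : ℤ) (τ : AlgebraicClosure K ≃+* AlgebraicClosure K) (hτ : IsLiftOfAut c τ)
        (A : ℕ → AddSubgroup (geomPoints (W.baseChange K)))
        (hA : ∀ m, KolyvaginCocycle.IsAdmissible (Field.absoluteGaloisGroup K) (A m) (q : ℤ))
        (Pt : ℕ → geomPoints (W.baseChange K))
        (hPt : ∀ m, Pt m ∈ KolyvaginCocycle.invPoints (Field.absoluteGaloisGroup K) (A m) (q : ℤ)),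
        (ε = 1 ∨ ε = -1) ∧
        IsOfFinAddOrder (Affine.Point.map (W' := W) (c : K →ₐ[ℚ] K) P - ε • P) ∧
        (∀ m, ∀ a ∈ A m, hτ.pointsMap W a ∈ A m) ∧
        Pt 1 = toGeomPoints (W.baseChange K) P ∧
        (∀ m : ℕ, Squarefree m →
          (∀ q' ∈ m.primeFactors, IsKolyvaginPrime N W K 2 q' ∧ FrobEqFrobInfty W K q q') →
          (∃ B ∈ A m, hτ.pointsMap W (Pt m) =
            (ε * (-1) ^ m.primeFactors.card) • Pt m + (q : ℤ) • B) ∧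
          (∀ v : HeightOneSpectrum (𝓞 K), (m : 𝓞 K) ∉ v.asIdeal →
            kolyvaginClass (W.baseChange K) _ hdiv (hA m) (Pt m) (hPt m) ∈
              selmerLocalKer (W.baseChange K) (v.adicCompletion K) (q : ℤ)) ∧
          (∀ ℓ : ℕ, ℓ.Prime → ℓ ∣ m → ∀ v : HeightOneSpectrum (𝓞 K), (ℓ : 𝓞 K) ∈ v.asIdeal →
            ∀ a : ℕ, ((((2 : ℕ) : ℤ) ^ a) •
                kolyvaginClass (W.baseChange K) _ hdiv (hA m) (Pt m) (hPt m) ∈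
                selmerLocalKer (W.baseChange K) (v.adicCompletion K) (q : ℤ) ↔
              (((2 : ℕ) : ℤ) ^ a) • kolyvaginClass (W.baseChange K) _ hdiv (hA (m / ℓ)) (Pt (m / ℓ))
                  (hPt (m / ℓ)) ∈
                (W.baseChange K).torsionLocalKer (v.adicCompletion K) (q : ℤ)))))
    (hRT : ∀ {ℓ : ℕ} (hℓ : IsKolyvaginPrime N W K 2 ℓ), FrobEqFrobInfty W K q ℓ →
      ∃ (A : Type) (_ : AddCommGroup A)
        (e : geomTorsion (W.baseChange K) (q : ℤ) →+ geomTorsion (W.baseChange K) (q : ℤ) →+ A),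
        (∀ x, e x x = 0) ∧ (∀ x, (∀ y, e x y = 0) → x = 0) ∧
        ∀ (T : Finset (HeightOneSpectrum (𝓞 K))),
        ∀ s ∈ selmerGroup (W.baseChange K) (q : ℤ),
          (∀ v ∈ T, s ∈ (W.baseChange K).torsionLocalKer (v.adicCompletion K) (q : ℤ)) →
          ∀ c' : galH1Torsion (W.baseChange K) (q : ℤ),
          (∀ v : HeightOneSpectrum (𝓞 K), v ∉ T → (ℓ : 𝓞 K) ∉ v.asIdeal →
            c' ∈ selmerLocalKer (W.baseChange K) (v.adicCompletion K) (q : ℤ)) →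
          (∀ w : InfinitePlace K, c' ∈ selmerLocalKer (W.baseChange K) w.Completion (q : ℤ)) →
          ∀ 𝔔 ∈ hℓ.place.primesAbove, ∀ F : Field.absoluteGaloisGroup K,
            IsArithFrobAt (𝓞 K) F 𝔔 → F ∈ torsionFixing (W.baseChange K) (q : ℤ) →
            ∀ σ ∈ 𝔔.inertia (Field.absoluteGaloisGroup K),
            e (h1Eval (W.baseChange K) (q : ℤ) s F) (h1Eval (W.baseChange K) (q : ℤ) c' σ) = 0) :
    ∀ s ∈ selmerGroup (W.baseChange K) (q : ℤ), conjAct W c (q : ℤ) s = s := by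
  subst hq
  classical
  haveI : Fact (Nat.Prime 2) := ⟨Nat.prime_two⟩
  haveI : Algebra.IsQuadraticExtension ℚ K := ⟨hK.1⟩
  haveI : IsTotallyComplex K := hK.2
  intro s hs
  -- ### the classes `c(m)` from the points (McCallum's cocycle), `c(1) = δ₂ y_K` (McCallum (6))
  have hdiv : ∀ Q : geomPoints (W.baseChange K), ∃ R, (((2 : ℕ) : ℕ) : ℤ) • R = Q :=
    (W.baseChange K).zsmul_geomPoints_surjective_holds (by norm_num)
  obtain ⟨ε, τ, hτ, A, hA, Pt, hPt, hε, -, hAτ, hPt1, hrel⟩ := hpoints hdiv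
  -- (`cl` kept OPAQUE: a transparent `set` lets the unifier unfold `kolyvaginClass` and time out)
  obtain ⟨cl, hcl⟩ : ∃ cl : ℕ → galH1Torsion (W.baseChange K) (((2 : ℕ) : ℕ) : ℤ),
      ∀ m, cl m = kolyvaginClass (W.baseChange K) _ hdiv (hA m) (Pt m) (hPt m) := ⟨_, fun _ ↦ rfl⟩
  have hP1 : toGeomPoints (W.baseChange K) P ∈
      KolyvaginCocycle.invPoints (Field.absoluteGaloisGroup K) (A 1) (((2 : ℕ) : ℕ) : ℤ) := by
    rw [← hPt1]; exact hPt 1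
  have hc1 : cl 1 = kummerMapTorsion (W.baseChange K) _ hdiv P := by
    rw [hcl 1, KolyvaginDescent.kolyvaginClass_congr_point (hA 1) (hP' := hP1) hPt1]
    exact kolyvaginClass_toGeomPoints (hA 1) P hP1
  -- ### `2 · H¹(K, E₂) = 0`
  have h2 : ∀ z : galH1Torsion (W.baseChange K) (((2 : ℕ) : ℕ) : ℤ), z + z = 0 := fun z ↦ by
    have h : (2 : ℤ) • z = 0 := zsmul_galH1Torsion_eq_zero (W.baseChange K) _ z
    rwa [two_zsmul] at h
  have hneg : ∀ z : galH1Torsion (W.baseChange K) (((2 : ℕ) : ℕ) : ℤ), -z = z := fun z ↦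
    neg_eq_of_add_eq_zero_left (h2 z)
  -- ### `x = c(1) = δ₂ y_K ≠ 0` (as `y_K ∉ 2E(K)`), and `c_* x = ε x = x`
  have hx0 : cl 1 ≠ 0 := by
    intro h0
    have hker : P ∈ (kummerMapTorsion (W.baseChange K) _ hdiv).ker := by
      rw [AddMonoidHom.mem_ker, ← hc1, h0]
    rw [kummerMapTorsion_ker, AddMonoidHom.mem_range] at hker
    obtain ⟨R, hR⟩ := hker
    refine hy R ?_
    have hR' : (((2 : ℕ) : ℕ) : ℤ) • R = P := hR
    rwa [natCast_zsmul] at hR'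
  have hone : ∀ q' ∈ (1 : ℕ).primeFactors, IsKolyvaginPrime N W K 2 q' ∧ FrobEqFrobInfty W K 2 q' :=
    fun q' hq' ↦ absurd hq' (by simp)
  have hx1 : conjAct W c _ (cl 1) = cl 1 := by
    have h := conjAct_kolyvaginClass_eq_smul W (hdiv := hdiv) hτ (hA 1) (hAτ 1) (hPt 1) _
      (hrel 1 squarefree_one hone).1
    rw [← hcl 1, Nat.primeFactors_one, Finset.card_empty, pow_zero, mul_one] at h
    rcases hε with rfl | rfl
    · rwa [one_smul] at h
    · rwa [neg_one_zsmul, hneg] at h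
  -- ### suppose `u = c_* s − s ≠ 0`; `c_* u = −u = u`
  by_contra hne
  have hcard : Nat.card (K ≃ₐ[ℚ] K) = 2 := by rw [IsGalois.card_aut_eq_finrank, hK.1]
  have hcc : c * c = 1 := by
    have h := pow_card_eq_one' (G := K ≃ₐ[ℚ] K) (x := c)
    rwa [hcard, pow_two] at h
  have hu0 : conjAct W c _ s - s ≠ 0 := fun h ↦ hne (sub_eq_zero.mp h)
  have hτu : conjAct W c _ (conjAct W c _ s - s) = conjAct W c _ s - s := by
    rw [map_sub, conjAct_conjAct_of_mul_self W hcc, ← neg_sub, hneg]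
  -- ### Čebotarev at `2`: a Kolyvagin prime `ℓ` of `(2, 1)` with `u_λ ≠ 0` and `x_λ ≠ 0`
  have hC := Literature.NumberTheory.Automorphic.chebotarev_artinRep_holds
  obtain ⟨ℓ, hℓK, hux⟩ : ∃ ℓ : ℕ, IsKolyvaginPrime N W K 2 ℓ ∧
      ∀ v : HeightOneSpectrum (𝓞 K), (ℓ : 𝓞 K) ∈ v.asIdeal →
        conjAct W c _ s - s ∉
            (W.baseChange K).torsionLocalKer (v.adicCompletion K) (((2 : ℕ) : ℕ) : ℤ) ∧
          cl 1 ∉ (W.baseChange K).torsionLocalKer (v.adicCompletion K) (((2 : ℕ) : ℕ) : ℤ) := by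
    by_cases hux : conjAct W c _ s - s = cl 1
    · -- family `(x)`
      obtain ⟨ℓ, -, hℓ, hℓN, hℓD, hℓ2, hprime, hfrob, hloc⟩ :=
        KolyvaginImageTwo.exists_kolyvaginPrime_gt_two hC (N := N) W hK hρ hΔ hΔK hc ![cl 1]
          (fun i ↦ by fin_cases i; exact hx1) (fun _ ↦ 1) (fun _ ↦ le_rfl)
          (dvd_two_of_sum_one h2 hx0) 0
      refine ⟨ℓ, ⟨hℓ, hℓN, hℓD, hℓ2, hprime, hfrob⟩, fun v hv ↦ ?_⟩
      have h1 := hloc 0 v hv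
      simp only [Matrix.cons_val_zero, one_ne_zero, iff_false] at h1
      exact ⟨hux ▸ h1, h1⟩
    · -- family `(u, x)`
      obtain ⟨ℓ, -, hℓ, hℓN, hℓD, hℓ2, hprime, hfrob, hloc⟩ :=
        KolyvaginImageTwo.exists_kolyvaginPrime_gt_two hC (N := N) W hK hρ hΔ hΔK hc
          ![conjAct W c _ s - s, cl 1]
          (fun i ↦ by fin_cases i; exacts [hτu, hx1]) (fun _ ↦ 1) (fun _ ↦ le_rfl)
          (dvd_two_of_sum_two h2 hu0 hx0 hux) 0
      refine ⟨ℓ, ⟨hℓ, hℓN, hℓD, hℓ2, hprime, hfrob⟩, fun v hv ↦ ?_⟩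
      have h0 := hloc 0 v hv
      have h1 := hloc 1 v hv
      simp only [Matrix.cons_val_zero, Matrix.cons_val_one, one_ne_zero, iff_false] at h0 h1
      exact ⟨h0, h1⟩
  have hfrob1 : FrobEqFrobInfty W K 2 ℓ := hℓK.2.2.2.2.2
  have hℓprime : ℓ.Prime := hℓK.prime
  -- ### Kolyvagin's class `d = c(ℓ)`: `(−ε)`-eigen, Selmer off `ℓ` and at `∞`, NOT Selmer at `λ`
  have hkol : ∀ q' ∈ ℓ.primeFactors, IsKolyvaginPrime N W K 2 q' ∧ FrobEqFrobInfty W K 2 q' := by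
    intro q' hq'
    rw [hℓprime.primeFactors, Finset.mem_singleton] at hq'
    subst hq'
    exact ⟨hℓK, hfrob1⟩
  obtain ⟨h541, hdsel, hdloc⟩ := hrel ℓ hℓprime.squarefree hkol
  have hdeig : conjAct W c _ (cl ℓ) = (ε * (-1) ^ ℓ.primeFactors.card) • cl ℓ := by
    rw [hcl ℓ]
    exact conjAct_kolyvaginClass_eq_smul W (hdiv := hdiv) hτ (hA ℓ) (hAτ ℓ) (hPt ℓ) _ h541
  have hdsel' : ∀ v : HeightOneSpectrum (𝓞 K), (ℓ : 𝓞 K) ∉ v.asIdeal →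
      cl ℓ ∈ selmerLocalKer (W.baseChange K) (v.adicCompletion K) (((2 : ℕ) : ℕ) : ℤ) := fun v hv ↦ by
    rw [hcl ℓ]; exact hdsel v hv
  have hdloc' : cl ℓ ∈ selmerLocalKer (W.baseChange K) (hℓK.place.adicCompletion K) (((2 : ℕ) : ℕ) : ℤ) ↔
      cl (ℓ / ℓ) ∈ (W.baseChange K).torsionLocalKer (hℓK.place.adicCompletion K) (((2 : ℕ) : ℕ) : ℤ) := by
    have h := hdloc ℓ hℓprime dvd_rfl hℓK.place hℓK.mem_place 0
    rw [pow_zero, one_smul, one_smul, ← hcl ℓ, ← hcl (ℓ / ℓ)] at h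
    exact h
  rw [Nat.div_self hℓprime.pos] at hdloc'
  have hν : ε * (-1) ^ ℓ.primeFactors.card = 1 ∨ ε * (-1) ^ ℓ.primeFactors.card = -1 := by
    rw [hℓprime.primeFactors, Finset.card_singleton, pow_one]
    rcases hε with rfl | rfl <;> simp
  have hdv : cl ℓ ∉ selmerLocalKer (W.baseChange K) (hℓK.place.adicCompletion K) (((2 : ℕ) : ℕ) : ℤ) :=
    fun hmem ↦ (hux hℓK.place hℓK.mem_place).2 (hdloc'.mp hmem)
  have hdinf : ∀ w : InfinitePlace K,
      cl ℓ ∈ selmerLocalKer (W.baseChange K) w.Completion (((2 : ℕ) : ℕ) : ℤ) := fun w ↦ by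
    haveI : IsAlgClosed w.Completion := isAlgClosed_of_ringEquiv
      (InfinitePlace.Completion.ringEquivComplexOfIsComplex (IsTotallyComplex.isComplex w)).symm
    rw [WeierstrassCurve.selmerLocalKer_eq_top_of_isAlgClosed]
    trivial
  have hgood : (W.baseChange K).HasGoodReductionAt hℓK.place := by
    have h := IsKolyvaginPrime.not_mem_badPlaces (W := W) hP hℓK
    rwa [WeierstrassCurve.mem_badPlaces_iff, not_not] at h
  -- ### leaf (B) at two: `(c_* s − s)_λ = 0` — contradiction
  obtain ⟨B, _, e, halt, hnd, hRe⟩ := hRT hℓK hfrob1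
  have hfin := lemma_5_3_descent_two W hK hc hℓK (q := 2) rfl hfrob1 hgood e halt hnd hν hdeig hdv hs
    (fun 𝔔 h𝔔 F hF hFT σ hσ ↦ hRe ∅ s hs (fun _ h ↦ absurd h (Finset.notMem_empty _)) (cl ℓ)
      (fun v _ hv ↦ hdsel' v hv) hdinf 𝔔 h𝔔 F hF hFT σ hσ)
  exact (hux hℓK.place hℓK.mem_place).1 hfin

/-- **The same with the machine's inputs as ty2's DATA (`P2.KolyvaginMachine`, p601266), full
support**: a point-system family and a reciprocity family at `p = 2` (used at level `M = 1` only) give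
`c_* s = s` on `Sel₂(E/K)` when `y_K ∉ 2E(K)` (`ρ̄_{E,2}` onto, `Δ_E < 0`, `Δ_E ∉ K²`). For the route's
CM-inert support `S := Rank1Residual.CMInert W` one needs in addition that every Gross-form Kolyvagin
prime of `(2, 1)` is inert in `F` (on H₂: `Frob_ℓ` is a transposition on `E[2]`, so `ℓ` is inert in
`ℚ(√Δ_E) = F`; not restated here). [cite: GrossLMS1991, Prop. 2.1 with §10 (proof)]
[cite: McCallumLMS1991, §2 Prop. 2.2, §5 Lemma 5.3] -/
theorem conjAct_eq_self_of_families_two {N : ℕ} [NeZero N] [W.IsElliptic]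
    (hK : IsImaginaryQuadratic K) {P : (W.baseChange K).toAffine.Point} (hP : IsHeegnerPoint N W K P)
    (hρ : W.HasSurjectiveModNGaloisRep 2) (hΔ : W.Δ < 0) (hΔK : ¬ IsSquare (W.baseChange K).Δ)
    {c : K ≃ₐ[ℚ] K} (hc : c ≠ 1) (hy : ∀ Q : (W.baseChange K).toAffine.Point, 2 • Q ≠ P)
    (D : Rank1Residual.P2.KolyvaginMachine.PointSystemFamily N W K P 2 fun _ ↦ True)
    (R : Rank1Residual.P2.KolyvaginMachine.ReciprocityFamily N W K 2 fun _ ↦ True) :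
    ∀ s ∈ selmerGroup (W.baseChange K) ((2 ^ 1 : ℕ) : ℤ), conjAct W c ((2 ^ 1 : ℕ) : ℤ) s = s := by
  refine conjAct_eq_self_of_mem_selmerGroup_two W hK hP hρ hΔ hΔK hc hy (q := 2 ^ 1) (pow_one 2)
    ?_ ?_
  · intro hdiv
    obtain ⟨ε, τ, hτ, A, hA, Pt, hPt, hε, h53, hAτ, hPt1, hm'⟩ :=
      Rank1Residual.P2.KolyvaginMachine.hpoints_of_pointSystemFamily D le_rfl hdiv c hc
    exact ⟨ε, τ, hτ, A, hA, Pt, hPt, hε, h53, hAτ, hPt1, fun m hm hq ↦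
      hm' m hm fun q hq' ↦ ⟨(hq q hq').1, (hq q hq').2, trivial⟩⟩
  · intro ℓ hℓ hF
    exact Rank1Residual.P2.KolyvaginMachine.hRT_of_reciprocityFamily R le_rfl hℓ hF trivial

/-! ## Appended (g6, same seat): the habitat form — on H₂ the hypotheses `Δ < 0`, `Δ ∉ K²` are automatic -/

/-- **The `τ`-part descent ON THE HABITAT H₂ of the route** (`HasCM`, `2` inert in `F = Frac End E`,
`ρ̄_{E,2}` onto; `K` imaginary quadratic with the Heegner hypothesis for `N_E`): there `Δ_E < 0`
(`KolyvaginEigenTwo.Δ_neg_of_cmInert_two`, p591040) and `Δ_E ∉ K²`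
(`KolyvaginImageTwo.not_isSquare_algebraMap_Δ_of_cmInert_two_of_heegner`, p596346) are automatic, so:
for a Heegner point `y_K = P ∈ E(K)` of level `N` with `P ∉ 2E(K)` and the machine's two inputs at
`(2, 1)` (hypotheses at `2`), complex conjugation acts trivially on `Sel₂(E/K)`.
[cite: GrossLMS1991, Prop. 2.1 with §10 (proof), (4.4), Props. 5.3, 6.2]
[cite: McCallumLMS1991, §2 Prop. 2.2, §3 Cor. 3.2, §5 Lemma 5.3] -/
theorem conjAct_eq_self_of_cmInert_two_of_heegner {N : ℕ} [NeZero N] [W.IsElliptic]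
    [W.IsGloballyMinimal] (hCM : W.HasCM)
    (hin : Literature.NumberTheory.EllipticCurves.Rank1Residual.CMInert W 2)
    (hρ : W.HasSurjectiveModNGaloisRep 2) (hK : IsImaginaryQuadratic K)
    (hH : SatisfiesHeegnerHypothesis (W.conductorNorm ℤ) K)
    {P : (W.baseChange K).toAffine.Point} (hP : IsHeegnerPoint N W K P)
    {c : K ≃ₐ[ℚ] K} (hc : c ≠ 1) (hy : ∀ Q : (W.baseChange K).toAffine.Point, 2 • Q ≠ P)
    {q : ℕ} (hq : q = 2)
    (hpoints : ∀ (hdiv : ∀ Q : geomPoints (W.baseChange K), ∃ R, (q : ℤ) • R = Q),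
      ∃ (ε : ℤ) (τ : AlgebraicClosure K ≃+* AlgebraicClosure K) (hτ : IsLiftOfAut c τ)
        (A : ℕ → AddSubgroup (geomPoints (W.baseChange K)))
        (hA : ∀ m, KolyvaginCocycle.IsAdmissible (Field.absoluteGaloisGroup K) (A m) (q : ℤ))
        (Pt : ℕ → geomPoints (W.baseChange K))
        (hPt : ∀ m, Pt m ∈ KolyvaginCocycle.invPoints (Field.absoluteGaloisGroup K) (A m) (q : ℤ)),
        (ε = 1 ∨ ε = -1) ∧
        IsOfFinAddOrder (Affine.Point.map (W' := W) (c : K →ₐ[ℚ] K) P - ε • P) ∧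
        (∀ m, ∀ a ∈ A m, hτ.pointsMap W a ∈ A m) ∧
        Pt 1 = toGeomPoints (W.baseChange K) P ∧
        (∀ m : ℕ, Squarefree m →
          (∀ q' ∈ m.primeFactors, IsKolyvaginPrime N W K 2 q' ∧ FrobEqFrobInfty W K q q') →
          (∃ B ∈ A m, hτ.pointsMap W (Pt m) =
            (ε * (-1) ^ m.primeFactors.card) • Pt m + (q : ℤ) • B) ∧
          (∀ v : HeightOneSpectrum (𝓞 K), (m : 𝓞 K) ∉ v.asIdeal →
            kolyvaginClass (W.baseChange K) _ hdiv (hA m) (Pt m) (hPt m) ∈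
              selmerLocalKer (W.baseChange K) (v.adicCompletion K) (q : ℤ)) ∧
          (∀ ℓ : ℕ, ℓ.Prime → ℓ ∣ m → ∀ v : HeightOneSpectrum (𝓞 K), (ℓ : 𝓞 K) ∈ v.asIdeal →
            ∀ a : ℕ, ((((2 : ℕ) : ℤ) ^ a) •
                kolyvaginClass (W.baseChange K) _ hdiv (hA m) (Pt m) (hPt m) ∈
                selmerLocalKer (W.baseChange K) (v.adicCompletion K) (q : ℤ) ↔
              (((2 : ℕ) : ℤ) ^ a) • kolyvaginClass (W.baseChange K) _ hdiv (hA (m / ℓ)) (Pt (m / ℓ))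
                  (hPt (m / ℓ)) ∈
                (W.baseChange K).torsionLocalKer (v.adicCompletion K) (q : ℤ)))))
    (hRT : ∀ {ℓ : ℕ} (hℓ : IsKolyvaginPrime N W K 2 ℓ), FrobEqFrobInfty W K q ℓ →
      ∃ (A : Type) (_ : AddCommGroup A)
        (e : geomTorsion (W.baseChange K) (q : ℤ) →+ geomTorsion (W.baseChange K) (q : ℤ) →+ A),
        (∀ x, e x x = 0) ∧ (∀ x, (∀ y, e x y = 0) → x = 0) ∧
        ∀ (T : Finset (HeightOneSpectrum (𝓞 K))),
        ∀ s ∈ selmerGroup (W.baseChange K) (q : ℤ),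
          (∀ v ∈ T, s ∈ (W.baseChange K).torsionLocalKer (v.adicCompletion K) (q : ℤ)) →
          ∀ c' : galH1Torsion (W.baseChange K) (q : ℤ),
          (∀ v : HeightOneSpectrum (𝓞 K), v ∉ T → (ℓ : 𝓞 K) ∉ v.asIdeal →
            c' ∈ selmerLocalKer (W.baseChange K) (v.adicCompletion K) (q : ℤ)) →
          (∀ w : InfinitePlace K, c' ∈ selmerLocalKer (W.baseChange K) w.Completion (q : ℤ)) →
          ∀ 𝔔 ∈ hℓ.place.primesAbove, ∀ F : Field.absoluteGaloisGroup K,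
            IsArithFrobAt (𝓞 K) F 𝔔 → F ∈ torsionFixing (W.baseChange K) (q : ℤ) →
            ∀ σ ∈ 𝔔.inertia (Field.absoluteGaloisGroup K),
            e (h1Eval (W.baseChange K) (q : ℤ) s F) (h1Eval (W.baseChange K) (q : ℤ) c' σ) = 0) :
    ∀ s ∈ selmerGroup (W.baseChange K) (q : ℤ), conjAct W c (q : ℤ) s = s := by
  have hΔ : W.Δ < 0 := KolyvaginEigenTwo.Δ_neg_of_cmInert_two W hCM hin hρ
  have hΔK : ¬ IsSquare (W.baseChange K).Δ := by
    have h : (W.baseChange K).Δ = algebraMap ℚ K W.Δ := by rw [baseChange, map_Δ]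
    rw [h]
    exact KolyvaginImageTwo.not_isSquare_algebraMap_Δ_of_cmInert_two_of_heegner W hCM hin hρ K hK hH
  exact conjAct_eq_self_of_mem_selmerGroup_two W hK hP hρ hΔ hΔK hc hy hq hpoints hRT

end Summit.BirchSwinnertonDyer.BirchSwinnertonDyer.Theorems.KolyvaginDescentTwo

end
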